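import Literature.Computability.MetaComplexity.OneSidedHeuristicsProofs
import Literature.Computability.MetaComplexity.MCSPProofs
import Literature.Computability.MetaComplexity.TruthTablesProofs
import Literature.Computability.MetaComplexity.AvgCaseNE
import Literature.Computability.Learning.SizeClassCounting
import Literature.Computability.Complexity.UniformProbBlocks
import Literature.Computability.Complexity.CoinCounting
import Literature.Computability.Complexity.NPClosureProofs
import Literature.Computability.Complexity.UnaryBricks
import HarnessLib

/-!
# Certified hard truth tables from one-sided heuristics for `coNP` on the uniform ensemble (Köbler–Schuler; Hirahara 2021, Lemma 3.4, item 2)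

Topic `Literature/Computability/MetaComplexity`, companion to `OneSidedHeuristics.lean` (`Avg¹_δ P`,
Hirahara's hypothesis `coNP × {U, T} ⊆ Avg¹_{1-n^{-c}} P`), `AvgCaseTallyNE.lean` (item 1 of the
proof sketch of Lemma 3.4: the tally half gives `NE = E`) and `AvgCaseDerandomizationBFP.lean`
(Buhrman–Fortnow–Pavan's Thm. 3.1 reduced to their Lemma 3.7). Item 2 of the proof sketch of
Lemma 3.4 of S. Hirahara, *Average-case hardness of NP from exponential worst-case hardness
assumptions* (STOC 2021; ECCC TR21-058, p. 20) reads

> "2. `coNP × {U} ⊆ Avg¹_{1-n^{-c}} P` implies `pr-MA = pr-NP` [KS04]."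

The mechanism (Köbler–Schuler 2004; also the use of the average-case hypothesis inside BFP's
Lemma 3.7) is that the hypothesis CERTIFIES HARD TRUTH TABLES: the language of easy truth tables
`MCSP[s]` is in `NP`, so its complement with the uniform ensemble is in `coNP × {U}`; a
one-sided-error heuristic for it never accepts an easy table and is correct with probability
`≥ n^{-c}`, hence accepts — and thereby certifies as hard — at least an `n^{-c} - Pr[easy]`
fraction of all tables. A nondeterministic machine can then guess a certified hard table and run a
pseudorandom generator on it (the derandomisation of Merlin–Arthur protocols itself needs the
table-based generator of Impagliazzo–Kabanets–Wigderson's Thm. 11, not in the tree). This file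
PROVES the certification step:

* `CertifiedHard.uniformProb_MCSPSize_le` — `Pr_{w ← {0,1}^{2^ℓ}}[w ∈ MCSP[s]] ≤ 2^{9(ℓ + s ℓ + 2)²} / 2^{2^ℓ}`
  (the count `Learning.ncard_sizeClass_B2_le` of functions with small `B₂`-circuits, transported
  along `truthTable`);
* `CertifiedHard.exists_certifier` — **for any threshold `s` with `MCSP[s] ∈ NP`: under
  `coNP × {U} ⊆ Avg¹_{1-n^{-c}} P` there is a polynomial-time `A(w; 1ⁿ)` accepting only truth tables
  of `B₂`-circuit complexity `> s ℓ` (at length `n = 2^ℓ`) and accepting a random table with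
  probability `≥ (2^ℓ)^{-c} - 2^{9(ℓ + s ℓ + 2)²}/2^{2^ℓ}`**;
* `CertifiedHard.MCSPSize_quarterExp_mem_NP` — `MCSP[2^{⌊ℓ/4⌋}] ∈ NP` (preimage of `MCSP ∈ NP`,
  `MCSP_mem_NP_holds`, under the `FP` reduction `w ↦ ⟨w, bin 2^{⌊log₂|w|⌋/4}⟩`);
  `CertifiedHard.exponent_le`, `CertifiedHard.count_div_le` — the count is `≤ 1/(2 (2^ℓ)^c)` for
  `ℓ ≥ 4(1090 + 8c)`;
* **`CertifiedHard.exists_certifier_quarterExp`**, **`Hirahara2021_exists_certifier_of_Avg1P`**,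
  **`exists_certifier_of_DistNP_subset_AvgP`** — at threshold `2^{⌊ℓ/4⌋}`: a polynomial-time
  certifier accepting only tables of circuit complexity `> 2^{⌊ℓ/4⌋}`, accepting a random table of
  length `2^ℓ` with probability `≥ 1/(2 (2^ℓ)^c)` for all `ℓ ≥ ℓ₀`, hence accepting some table at
  every large length; under `coNP × {U} ⊆ Avg¹_{1-n^{-c}} P`, under Hirahara's
  `coNP × {U, T} ⊆ Avg¹_{1-n^{-c}} P`, and under `DistNP ⊆ AvgP` (via
  `distClass_coNP_subset_Avg1DeltaP_of_DistNP_subset_AvgP`, p. 9).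

## References

* S. Hirahara, *Average-case hardness of NP from exponential worst-case hardness assumptions*,
  STOC 2021; ECCC TR21-058 (2021): Lemma 3.4 and its proof sketch (p. 20), Def. 3.3, p. 9
  [Hirahara2021] (text checked: ECCC TR21-058, p. 20).
* J. Köbler, R. Schuler, *Average-case intractability vs. worst-case intractability*, Inform. and
  Comput. 190 (2004) 1–17 (the cited source [KS04] of item 2).
* H. Buhrman, L. Fortnow, A. Pavan, *Some results on derandomization*, Theory Comput. Syst. 38
  (2005), Lemma 3.7 and its proof [BuhrmanFortnowPavan2004].
* V. Kabanets, J.-Y. Cai, *Circuit minimization problem*, STOC 2000, §2 (`MCSP ∈ NP`)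
  [KabanetsCai2000]; S. Arora, B. Barak, *Computational Complexity: A Modern Approach*, CUP 2009,
  Thm. 6.21 (counting small circuits) [AroraBarakCC2009].

## Design notes

* No named fact is introduced (D-0026); `quarterExp`, `quarterRed` are proof devices. The threshold
  `2^{⌊ℓ/4⌋}` is one convenient exponential choice (`2^{Ω(ℓ)}` hardness is what the Nisan–Wigderson /
  Impagliazzo–Wigderson generators consume); `exists_certifier` is stated for an arbitrary threshold
  `s` with `MCSP[s] ∈ NP`, with the explicit count, for other choices.
* Acceptance is read at the table's own length parameter, `A(w; 1^{2^ℓ})`, the format of `Avg¹_δ P`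
  (`Avg1DeltaP`, algorithms on `paramEnc (w, n) = ⟨w, 1ⁿ⟩`); a consumer guessing `w` of length `2^ℓ`
  runs `A` on `⟨w, 1^{|w|}⟩`.
-/

noncomputable section

namespace Literature.Computability.MetaComplexity

open _root_.Computability Complexity Complexity.Classes Complexity.Nondeterministic Brick Plumb Finset
open Literature.Computability.Learning

namespace CertifiedHard

/-! ### A. Truth tables of easy functions are rare -/

/-- **Easy truth tables of length `2^ℓ` are few**: the uniform probability that a string of length
`2^ℓ` lies in `MCSP[s]` (is the truth table of an `ℓ`-variable function of `B₂`-circuit complexity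
`≤ s ℓ`) is at most `2^{9(ℓ + s ℓ + 2)²} / 2^{2^ℓ}` (the count `ncard_sizeClass_B2_le` of functions with
small circuits, transported along `truthTable`). [Arora–Barak 2009, Thm. 6.21 (proof: counting
circuits); Kabanets–Cai 2000, §2] [cite: AroraBarakCC2009, Thm. 6.21 (proof)] -/
theorem uniformProb_MCSPSize_le (s : ℕ → ℕ) (ℓ : ℕ) :
    uniformProb (2 ^ ℓ) (MCSPSize s) ≤ (2 : ℝ) ^ (9 * (ℓ + s ℓ + 2) ^ 2) / 2 ^ (2 ^ ℓ) := by
  classical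
  rw [uniformProb_eq_card_fun]
  refine div_le_div_of_nonneg_right ?_ (by positivity)
  -- the functions `g : Fin (2^ℓ) → Bool` whose table is easy inject into `sizeClass B2 s ℓ`
  set φ : (Fin (2 ^ ℓ) → Bool) → ((Fin ℓ → Bool) → Bool) :=
    fun g => ofTruthTable (List.ofFn g) (by simp) with hφ
  have hmaps : ∀ g ∈ (univ.filter fun g : Fin (2 ^ ℓ) → Bool => List.ofFn g ∈ MCSPSize s),
      φ g ∈ (Set.toFinite (sizeClass B2 s ℓ)).toFinset := by
    intro g hg
    rw [mem_filter] at hg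
    obtain ⟨n, f, hgf, hf⟩ := hg.2
    have hn : n = ℓ := by
      have h := congrArg List.length hgf
      rw [List.length_ofFn, length_truthTable] at h
      exact (Nat.pow_right_injective le_rfl h).symm
    subst hn
    rw [Set.Finite.mem_toFinset, mem_sizeClass_iff]
    have hφg : φ g = f := by
      have h1 : truthTable (φ g) = truthTable f := by
        simp only [hφ, truthTable_ofTruthTable]
        exact hgf
      have h2 : ofTruthTable (truthTable (φ g)) (length_truthTable _) =
          ofTruthTable (truthTable f) (length_truthTable _) := by
        congr 1
      rwa [ofTruthTable_truthTable, ofTruthTable_truthTable] at h2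
    obtain ⟨C, hB, hC, hsz⟩ := exists_computes_B2_size_eq_holds f
    exact ⟨C, hB, hφg ▸ hC, hsz ▸ hf⟩
  have hinj : Set.InjOn φ ↑(univ.filter fun g : Fin (2 ^ ℓ) → Bool => List.ofFn g ∈ MCSPSize s) := by
    intro g₁ _ g₂ _ h
    have h' : truthTable (φ g₁) = truthTable (φ g₂) := by rw [h]
    simp only [hφ, truthTable_ofTruthTable] at h'
    exact List.ofFn_injective h'
  have hcard := Finset.card_le_card_of_injOn φ hmaps hinj
  rw [← Set.ncard_eq_toFinset_card _ (Set.toFinite (sizeClass B2 s ℓ))] at hcard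
  have h := hcard.trans (ncard_sizeClass_B2_le s ℓ)
  exact_mod_cast h

/-! ### B. The certifier extracted from a one-sided heuristic for `(MCSP[s]ᶜ, U)` -/

/-- **Certified hard truth tables from a one-sided-error heuristic (the Köbler–Schuler mechanism).**
Assume `coNP × {U} ⊆ Avg¹_{1-n^{-c}} P` and `MCSP[s] ∈ NP`. Then there are a polynomial-time
`A(w; 1ⁿ)` and a constant `c` such that (soundness) every truth table accepted at its length,
`A(tt(f); 1^{2^ℓ}) = 1`, has `B₂`-circuit complexity `> s ℓ`, and (abundance)
`Pr_{w ← {0,1}^{2^ℓ}}[A(w; 1^{2^ℓ}) = 1] ≥ (2^ℓ)^{-c} - 2^{9(ℓ + s ℓ + 2)²}/2^{2^ℓ}` for every `ℓ`: the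
heuristic for `(MCSP[s]ᶜ, U) ∈ coNP × {U}` never accepts an easy table (no false positives on the
support) and is correct with probability `≥ n^{-c}`, while it can be correct on an easy table only by
rejecting it. This is the step by which the hypothesis derandomises Merlin–Arthur protocols
("`coNP × {U} ⊆ Avg¹_{1-n^{-c}} P` implies `pr-MA = pr-NP` [KS04]": Merlin guesses a table accepted by
`A`, which is then certified hard and feeds a pseudorandom generator).
[Hirahara 2021 (ECCC TR21-058), Lemma 3.4, proof sketch, item 2 (p. 20), Def. 3.3; Köbler–Schuler
2004; Buhrman–Fortnow–Pavan 2005, proof of Lemma 3.7] [cite: Hirahara2021, Lemma 3.4 (proof sketch, item 2)] -/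
theorem exists_certifier
    (hU : ∃ c : ℕ, distClass coNP {uniformEnsemble} ⊆ Avg1DeltaP fun n => 1 - 1 / (n : ℝ) ^ c)
    {s : ℕ → ℕ} (hs : MCSPSize s ∈ NP) :
    ∃ (A : List Bool → ℕ → Bool) (c : ℕ),
      PolyTimeComputable paramEnc encodeBool (Function.uncurry A) ∧
      (∀ (ℓ : ℕ) (f : (Fin ℓ → Bool) → Bool), A (truthTable f) (2 ^ ℓ) = true →
        s ℓ < circuitSizeOver B2 f) ∧
      ∀ ℓ : ℕ, 1 / ((2 : ℝ) ^ ℓ) ^ c - 2 ^ (9 * (ℓ + s ℓ + 2) ^ 2) / 2 ^ (2 ^ ℓ) ≤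
        uniformProb (2 ^ ℓ) {w | A w (2 ^ ℓ) = true} := by
  obtain ⟨c, hc⟩ := hU
  have hco : (MCSPSize s)ᶜ ∈ coNP := by
    change (MCSPSize s)ᶜᶜ ∈ NP
    rwa [compl_compl]
  have hQ : (⟨(MCSPSize s)ᶜ, uniformEnsemble⟩ : DistProblem) ∈ distClass coNP {uniformEnsemble} :=
    ⟨hco, Set.mem_singleton _⟩
  obtain ⟨A, hA, h1, h2⟩ := hc hQ
  refine ⟨A, c, hA, fun ℓ f hacc => ?_, fun ℓ => ?_⟩
  · -- soundness: an accepted table is not in `MCSP[s]`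
    by_contra hle
    push Not at hle
    have hmem : truthTable f ∈ MCSPSize s := (truthTable_mem_MCSPSize_iff s f).2 hle
    have hsupp : truthTable f ∈ (uniformEnsemble (2 ^ ℓ)).support := by
      rw [mem_support_uniformEnsemble_iff, length_truthTable]
    have hfalse : A (truthTable f) (2 ^ ℓ) = false :=
      h1 (2 ^ ℓ) (truthTable f) hsupp (fun h => h hmem)
    rw [hfalse] at hacc
    exact Bool.false_ne_true hacc
  · -- abundance: the success event lies inside `{A = 1} ∪ MCSP[s]`
    have hsub : {x : List Bool | A x (2 ^ ℓ) = (MCSPSize s)ᶜ.boolIndicator x} ⊆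
        {w | A w (2 ^ ℓ) = true} ∪ MCSPSize s := by
      intro x hx
      by_cases hAx : A x (2 ^ ℓ) = true
      · exact Or.inl hAx
      · right
        have hAx' : A x (2 ^ ℓ) = false := by simpa using hAx
        have hind : (MCSPSize s)ᶜ.boolIndicator x = false := by
          rw [Set.mem_setOf_eq] at hx
          rw [← hx, hAx']
        have hnot : x ∉ (MCSPSize s)ᶜ := (Set.notMem_iff_boolIndicator _ _).2 hind
        exact not_not.1 hnot
    have hsucc := h2 (2 ^ ℓ)
    change 1 - (1 - 1 / ((2 ^ ℓ : ℕ) : ℝ) ^ c) ≤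
      uniformEnsemble.prob (2 ^ ℓ) {x | A x (2 ^ ℓ) = (MCSPSize s)ᶜ.boolIndicator x} at hsucc
    rw [prob_uniformEnsemble] at hsucc
    have hmono : uniformProb (2 ^ ℓ) {x : List Bool | A x (2 ^ ℓ) = (MCSPSize s)ᶜ.boolIndicator x} ≤
        uniformProb (2 ^ ℓ) ({w | A w (2 ^ ℓ) = true} ∪ MCSPSize s) := by
      classical
      unfold uniformProb
      refine div_le_div_of_nonneg_right ?_ (by positivity)
      exact_mod_cast Finset.card_le_card fun r hr => by
        simp only [Finset.mem_filter, Finset.mem_univ, true_and] at hr ⊢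
        exact hsub hr
    have hunion := uniformProb_union_le (2 ^ ℓ) {w | A w (2 ^ ℓ) = true} (MCSPSize s)
    have heasy := uniformProb_MCSPSize_le s ℓ
    push_cast at hsucc
    linarith

/-! ### C. A concrete threshold: `MCSP[2^{⌊ℓ/4⌋}] ∈ NP` and the count is eventually small -/

/-- The threshold `s(ℓ) = 2^{⌊ℓ/4⌋}` (exponential hardness, as the Nisan–Wigderson / Impagliazzo–
Wigderson generators want it). [folklore] -/
def quarterExp (ℓ : ℕ) : ℕ := 2 ^ (ℓ / 4)

/-- The reduction `w ↦ ⟨w, bin 2^{⌊log₂|w|⌋/4}⟩` from `MCSP[2^{⌊ℓ/4⌋}]` to `MCSP`. [folklore] -/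
def quarterRed : List Bool → List Bool :=
  fanoutFn id (AvgNE.pow2NumF 1 ∘ halfFn ∘ halfFn ∘ logFn)

/-- `quarterRed ∈ FP`. [folklore] -/
theorem quarterRed_mem_FP : quarterRed ∈ FP :=
  fanoutFn_mem_FP OracleCompose.id_mem_FP (comp_mem_FP (AvgNE.pow2NumF_mem_FP 1)
    (comp_mem_FP halfFn_mem_FP (comp_mem_FP halfFn_mem_FP logFn_mem_FP)))

/-- Value of the reduction. [folklore] -/
theorem quarterRed_apply (w : List Bool) :
    quarterRed w = boolPair w (encodeNat (2 ^ (Nat.log 2 w.length / 4))) := by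
  have hnum : ∀ u : List Bool, AvgNE.pow2NumF 1 u = encodeNat (2 ^ u.length) := fun u => by
    have h := encodeNat_bitsToNat (isCanonicalNum_append_true (Kannan.zerosFn (onesMulFn 1 u)))
    rw [← AvgNE.pow2NumF, AvgNE.bitsToNat_pow2NumF, Nat.one_mul] at h
    exact h.symm
  have hdiv : Nat.log 2 w.length / 2 / 2 = Nat.log 2 w.length / 4 := by
    rw [Nat.div_div_eq_div_mul]
  simp only [quarterRed, fanoutFn_apply, id, Function.comp_apply, hnum, halfFn, logFn, ones,
    List.length_replicate, hdiv]

/-- **`MCSP[2^{⌊ℓ/4⌋}] ∈ NP`**: it is the preimage of `MCSP ∈ NP` (`MCSP_mem_NP_holds`) under the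
polynomial-time reduction `quarterRed`. [Kabanets–Cai 2000, §2 (Thm. 2.2)] [cite: KabanetsCai2000, §2] -/
theorem MCSPSize_quarterExp_mem_NP : MCSPSize quarterExp ∈ NP := by
  have hpre : MCSPSize quarterExp = quarterRed ⁻¹' MCSP := by
    ext w
    change w ∈ MCSPSize quarterExp ↔ quarterRed w ∈ MCSP
    rw [quarterRed_apply]
    constructor
    · rintro ⟨n, f, rfl, hf⟩
      rw [boolPair_truthTable_mem_MCSP_iff, length_truthTable, Nat.log_pow one_lt_two]
      exact hf
    · rintro ⟨m, g, t, hw, hg⟩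
      have h1 : (w, encodeNat (2 ^ (Nat.log 2 w.length / 4))) = (truthTable g, encodeNat t) :=
        boolPair_injective hw
      obtain ⟨rfl, h2⟩ := Prod.mk.inj h1
      have ht := congrArg decodeNat h2
      rw [decode_encodeNat, decode_encodeNat, length_truthTable, Nat.log_pow one_lt_two] at ht
      refine ⟨m, g, rfl, ?_⟩
      rw [quarterExp, ht]
      exact hg
  rw [hpre]
  exact preimage_mem_NP MCSP_mem_NP_holds quarterRed_mem_FP

/-- The exponent inequality behind the abundance of certified tables at threshold `2^{⌊ℓ/4⌋}`:
`1 + cℓ + 9(ℓ + 2^{⌊ℓ/4⌋} + 2)² ≤ 2^ℓ` once `ℓ ≥ 4(1090 + 8c)`. [folklore] -/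
theorem exponent_le (c ℓ : ℕ) (hℓ : 4 * (1090 + 8 * c) ≤ ℓ) :
    1 + c * ℓ + 9 * (ℓ + 2 ^ (ℓ / 4) + 2) ^ 2 ≤ 2 ^ ℓ := by
  set q := ℓ / 4 with hq
  set K := 1090 + 8 * c with hK
  have hKq : K ≤ q := by rw [hq]; omega
  have hq1 : 1 ≤ 2 ^ q := Nat.one_le_two_pow
  have hℓq : ℓ ≤ 4 * q + 3 := by rw [hq]; omega
  -- `ℓ + 2^q + 2 ≤ 11 · 2^q`
  have hq2 : 4 * q + 5 ≤ 10 * 2 ^ q := by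
    have := @Nat.lt_two_pow_self q
    omega
  have hbase : ℓ + 2 ^ q + 2 ≤ 11 * 2 ^ q := by omega
  have hsq : 9 * (ℓ + 2 ^ q + 2) ^ 2 ≤ 1089 * 4 ^ q := by
    have h := Nat.mul_le_mul hbase hbase
    have : 4 ^ q = 2 ^ q * 2 ^ q := by
      rw [show (4 : ℕ) = 2 * 2 by norm_num, mul_pow]
    nlinarith
  have hlin : 1 + c * ℓ ≤ (1 + 8 * c) * 4 ^ q := by
    have h4 : 2 ^ q ≤ 4 ^ q := Nat.pow_le_pow_left (by norm_num) q
    nlinarith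
  have hK4 : K ≤ 4 ^ q := (Nat.lt_pow_self (by norm_num : 1 < 4)).le.trans
    (Nat.pow_le_pow_right (by norm_num) hKq)
  have hpow : 4 ^ q * 4 ^ q ≤ 2 ^ ℓ := by
    rw [← pow_add, show (4 : ℕ) = 2 ^ 2 by norm_num, ← pow_mul]
    exact Nat.pow_le_pow_right two_pos (by omega)
  calc 1 + c * ℓ + 9 * (ℓ + 2 ^ (ℓ / 4) + 2) ^ 2
      ≤ (1 + 8 * c) * 4 ^ q + 1089 * 4 ^ q := Nat.add_le_add hlin hsq
    _ = K * 4 ^ q := by rw [hK]; ring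
    _ ≤ 4 ^ q * 4 ^ q := Nat.mul_le_mul_right _ hK4
    _ ≤ 2 ^ ℓ := hpow

/-- Real form: `2^{9(ℓ + 2^{⌊ℓ/4⌋} + 2)²} / 2^{2^ℓ} ≤ 1 / (2 · (2^ℓ)^c)` for `ℓ ≥ 4(1090 + 8c)`. [folklore] -/
theorem count_div_le (c ℓ : ℕ) (hℓ : 4 * (1090 + 8 * c) ≤ ℓ) :
    (2 : ℝ) ^ (9 * (ℓ + quarterExp ℓ + 2) ^ 2) / 2 ^ (2 ^ ℓ) ≤ 1 / (2 * ((2 : ℝ) ^ ℓ) ^ c) := by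
  have hexp := exponent_le c ℓ hℓ
  rw [div_le_div_iff₀ (by positivity) (by positivity), one_mul]
  have h : (2 : ℝ) ^ (9 * (ℓ + quarterExp ℓ + 2) ^ 2) * (2 * ((2 : ℝ) ^ ℓ) ^ c) =
      2 ^ (1 + c * ℓ + 9 * (ℓ + 2 ^ (ℓ / 4) + 2) ^ 2) := by
    rw [quarterExp, ← pow_mul, pow_add, pow_add, pow_one]
    ring
  rw [h]
  exact pow_le_pow_right₀ one_le_two hexp

/-! ### D. The certifier at threshold `2^{⌊ℓ/4⌋}` -/

/-- **Köbler–Schuler certified hardness under `coNP × {U} ⊆ Avg¹_{1-n^{-c}} P`, at threshold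
`2^{⌊ℓ/4⌋}`.** There are a polynomial-time `A(w; 1ⁿ)`, a constant `c` and `ℓ₀` such that:
every accepted table `A(tt(f); 1^{2^ℓ}) = 1` has `B₂`-circuit complexity `> 2^{⌊ℓ/4⌋}`; for all
`ℓ ≥ ℓ₀` a uniformly random table of length `2^ℓ` is accepted with probability `≥ 1/(2 (2^ℓ)^c)`;
in particular for all `ℓ ≥ ℓ₀` some `ℓ`-variable function is accepted (and thereby certified hard).
[Hirahara 2021 (ECCC TR21-058), Lemma 3.4, proof sketch, item 2 (p. 20); Köbler–Schuler 2004;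
Buhrman–Fortnow–Pavan 2005, proof of Lemma 3.7; Arora–Barak 2009, Thm. 6.21]
[cite: Hirahara2021, Lemma 3.4 (proof sketch, item 2)] -/
theorem exists_certifier_quarterExp
    (hU : ∃ c : ℕ, distClass coNP {uniformEnsemble} ⊆ Avg1DeltaP fun n => 1 - 1 / (n : ℝ) ^ c) :
    ∃ (A : List Bool → ℕ → Bool) (c ℓ₀ : ℕ),
      PolyTimeComputable paramEnc encodeBool (Function.uncurry A) ∧
      (∀ (ℓ : ℕ) (f : (Fin ℓ → Bool) → Bool), A (truthTable f) (2 ^ ℓ) = true →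
        2 ^ (ℓ / 4) < circuitSizeOver B2 f) ∧
      (∀ ℓ : ℕ, ℓ₀ ≤ ℓ → 1 / (2 * ((2 : ℝ) ^ ℓ) ^ c) ≤ uniformProb (2 ^ ℓ) {w | A w (2 ^ ℓ) = true}) ∧
      ∀ ℓ : ℕ, ℓ₀ ≤ ℓ → ∃ f : (Fin ℓ → Bool) → Bool, A (truthTable f) (2 ^ ℓ) = true := by
  obtain ⟨A, c, hA, hsound, habund⟩ := exists_certifier hU MCSPSize_quarterExp_mem_NP
  have hbound : ∀ ℓ : ℕ, 4 * (1090 + 8 * c) ≤ ℓ →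
      1 / (2 * ((2 : ℝ) ^ ℓ) ^ c) ≤ uniformProb (2 ^ ℓ) {w | A w (2 ^ ℓ) = true} := by
    intro ℓ hℓ
    have h1 := habund ℓ
    have h2 := count_div_le c ℓ hℓ
    have h3 : 1 / ((2 : ℝ) ^ ℓ) ^ c = 1 / (2 * ((2 : ℝ) ^ ℓ) ^ c) + 1 / (2 * ((2 : ℝ) ^ ℓ) ^ c) := by
      field_simp; ring
    change 1 / ((2 : ℝ) ^ ℓ) ^ c - 2 ^ (9 * (ℓ + quarterExp ℓ + 2) ^ 2) / 2 ^ (2 ^ ℓ) ≤ _ at h1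
    linarith
  refine ⟨A, c, 4 * (1090 + 8 * c), hA, fun ℓ f h => hsound ℓ f h, hbound, fun ℓ hℓ => ?_⟩
  -- a positive probability event contains a table, i.e. the truth table of some function
  have hpos : 0 < uniformProb (2 ^ ℓ) {w | A w (2 ^ ℓ) = true} :=
    lt_of_lt_of_le (by positivity) (hbound ℓ hℓ)
  unfold uniformProb at hpos
  rw [div_pos_iff_of_pos_right (by positivity), Nat.cast_pos, Finset.card_pos] at hpos
  obtain ⟨r, hr⟩ := hpos
  simp only [Finset.mem_filter, Finset.mem_univ, true_and, Set.mem_setOf_eq] at hr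
  refine ⟨ofTruthTable r.toList (by simp), ?_⟩
  rw [truthTable_ofTruthTable]
  exact hr

end CertifiedHard

/-! ### E. Under Hirahara's hypothesis and under `DistNP ⊆ AvgP` -/

/-- The uniform half of Hirahara's hypothesis: `coNP × {U, T} ⊆ Avg¹_{1-n^{-c}} P` implies
`coNP × {U} ⊆ Avg¹_{1-n^{-c}} P`. [Hirahara 2021 (ECCC TR21-058), p. 9 and Lemma 3.4]
[cite: Hirahara2021, Lemma 3.4] -/
theorem distClass_coNP_uniform_subset_Avg1DeltaP_of_weak
    (hyp : ∃ c : ℕ, distClass coNP {uniformEnsemble, tallyEnsemble} ⊆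
      Avg1DeltaP fun n => 1 - 1 / (n : ℝ) ^ c) :
    ∃ c : ℕ, distClass coNP {uniformEnsemble} ⊆ Avg1DeltaP fun n => 1 - 1 / (n : ℝ) ^ c := by
  obtain ⟨c, hc⟩ := hyp
  exact ⟨c, (distClass_mono le_rfl (Set.singleton_subset_iff.2 (Set.mem_insert _ _))).trans hc⟩

/-- **Certified hard truth tables under Hirahara's hypothesis `coNP × {U, T} ⊆ Avg¹_{1-n^{-c}} P`**
(the hypothesis of `Hirahara2021_UP_searchUHS_of_Avg1P`, `Hirahara2021_languageCompression`,
`Hirahara2021_gapKvsK_mem_PromiseP`): the mechanism of item 2 of the proof sketch of Lemma 3.4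
("`coNP × {U} ⊆ Avg¹_{1-n^{-c}} P` implies `pr-MA = pr-NP` [KS04]"). [Hirahara 2021 (ECCC TR21-058),
Lemma 3.4 (proof sketch, item 2); Köbler–Schuler 2004]
[cite: Hirahara2021, Lemma 3.4 (proof sketch, item 2)] -/
theorem Hirahara2021_exists_certifier_of_Avg1P
    (hyp : ∃ c : ℕ, distClass coNP {uniformEnsemble, tallyEnsemble} ⊆
      Avg1DeltaP fun n => 1 - 1 / (n : ℝ) ^ c) :
    ∃ (A : List Bool → ℕ → Bool) (c ℓ₀ : ℕ),
      PolyTimeComputable paramEnc encodeBool (Function.uncurry A) ∧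
      (∀ (ℓ : ℕ) (f : (Fin ℓ → Bool) → Bool), A (truthTable f) (2 ^ ℓ) = true →
        2 ^ (ℓ / 4) < circuitSizeOver B2 f) ∧
      (∀ ℓ : ℕ, ℓ₀ ≤ ℓ → 1 / (2 * ((2 : ℝ) ^ ℓ) ^ c) ≤ uniformProb (2 ^ ℓ) {w | A w (2 ^ ℓ) = true}) ∧
      ∀ ℓ : ℕ, ℓ₀ ≤ ℓ → ∃ f : (Fin ℓ → Bool) → Bool, A (truthTable f) (2 ^ ℓ) = true :=
  CertifiedHard.exists_certifier_quarterExp (distClass_coNP_uniform_subset_Avg1DeltaP_of_weak hyp)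

/-- **Certified hard truth tables under `DistNP ⊆ AvgP`** (the hypothesis of
`BuhrmanFortnowPavan2004_PromiseBPP'_subset_PromiseP`, whose remaining leaf, BFP's Lemma 3.7, uses the
average-case hypothesis exactly through the Köbler–Schuler derandomisation of Merlin–Arthur protocols
from a certified hard truth table): `DistNP ⊆ AvgP` gives `coNP × {U, T} ⊆ Avg¹_{1-1/n} P`
(`distClass_coNP_subset_Avg1DeltaP_of_DistNP_subset_AvgP`, Hirahara p. 9).
[Buhrman–Fortnow–Pavan 2005, Lemma 3.7 (proof); Hirahara 2021 (ECCC TR21-058), p. 9 and Lemma 3.4]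
[cite: BuhrmanFortnowPavan2004, Lemma 3.7 (proof)] -/
theorem exists_certifier_of_DistNP_subset_AvgP (hD : DistNP ⊆ AvgP) :
    ∃ (A : List Bool → ℕ → Bool) (c ℓ₀ : ℕ),
      PolyTimeComputable paramEnc encodeBool (Function.uncurry A) ∧
      (∀ (ℓ : ℕ) (f : (Fin ℓ → Bool) → Bool), A (truthTable f) (2 ^ ℓ) = true →
        2 ^ (ℓ / 4) < circuitSizeOver B2 f) ∧
      (∀ ℓ : ℕ, ℓ₀ ≤ ℓ → 1 / (2 * ((2 : ℝ) ^ ℓ) ^ c) ≤ uniformProb (2 ^ ℓ) {w | A w (2 ^ ℓ) = true}) ∧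
      ∀ ℓ : ℕ, ℓ₀ ≤ ℓ → ∃ f : (Fin ℓ → Bool) → Bool, A (truthTable f) (2 ^ ℓ) = true :=
  Hirahara2021_exists_certifier_of_Avg1P
    ⟨1, distClass_coNP_subset_Avg1DeltaP_of_DistNP_subset_AvgP hD one_ne_zero⟩

end Literature.Computability.MetaComplexity

end
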